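import Literature.NumberTheory.GaloisRepresentations.ArtinConductorExponentHasseArfProofs
import Literature.NumberTheory.GaloisRepresentations.HasseArfProofs
import HarnessLib

/-!
# Integrality of the Artin conductor of a `λ`-adic representation, proved
(companion to `ArtinConductorIntegrality.lean`; discharge of
`Literature.NumberTheory.GaloisRepresentations.GaloisRep.exists_natCast_eq_artinConductorAt_lAdic`)

Theorems only.  The named fact
`Literature.NumberTheory.GaloisRepresentations.GaloisRep.exists_natCast_eq_artinConductorAt_lAdic`
of `ArtinConductorIntegrality.lean` is Katz's Prop. 1.9 with Remark 1.10 (*Gauss Sums, Kloosterman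
Sums, and Monodromy Groups*, Ch. 1), transported to a prime `𝔓 ∣ v` of a number field `K`: for a
continuous representation `ρ : Γ_K → GL(M)` on a finite-dimensional vector space `M` over a finite
extension `E` of `ℚ_ℓ`, `ℓ ≠ p`, the Artin conductor
`a_𝔓(ρ) = codim M^{I_𝔓} + ∫₀^∞ codim M^{Γ_K^u} du` is a natural number.

Everything except the Hasse–Arf theorem was already assembled in the tree:
`exists_natCast_eq_artinConductorAt_lAdic_of_hasseArf` (`ArtinConductorExponentHasseArfProofs`)
derives the fact from `hasseArf` for the finite Galois extensions in the universe of `K`, through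

* Katz 1.8 / the remark before 1.9 (the wild inertia group `P` acts through a finite quotient of a
  continuous `ℓ`-adic representation, `ℓ ≠ p`: `ArtinConductorWildProofs`,
  `exists_natCast_eq_artinConductorAt_lAdic_of_artinExponent_charZero`);
* the compatibility of upper and lower numbering (Herbrand, Serre IV §3, Katz's proof of 1.9:
  `ArtinConductorIntegralityProofs`, `ArtinConductorHerbrandProofs`);
* Artin's theorem `f(χ) ∈ ℕ` for characters of the inertia group (Serre VI §2 Thm 1'), reduced by
  Brauer induction and the different to the degree-one integrality
  `|H ∩ G_0| ∣ Σ_{(H ∩ G_i) ⊄ ker θ} |H ∩ G_i|` (`ArtinConductorDischargeProofs`,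
  `ArtinRepresentationProofs`), and that in turn to Hasse–Arf
  (`card_inf_inertia_dvd_finsum_card_inf_ramificationSubgroup_of_hasseArf`,
  `ArtinRepresentationHasseArfProofs`).

The Hasse–Arf theorem is now the theorem `hasseArf_holds` (`HasseArfProofs`: Serre IV §3 and V §7,
proved completion-free for Dedekind domains), universe-polymorphic, so feeding it in closes the
fact: `exists_natCast_eq_artinConductorAt_lAdic_holds`.

## References

* N. M. Katz, *Gauss Sums, Kloosterman Sums, and Monodromy Groups*, Annals of Math. Studies 116,
  Princeton 1988, Ch. 1: 1.1, 1.8, Prop. 1.9 and its proof, Remark 1.10. [Katz1988]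
* J.-P. Serre, *Local Fields*, GTM 67 (1979), Ch. IV §3 (Herbrand, Hasse–Arf); Ch. V §7; Ch. VI §2
  Thm 1'. [SerreLocalFields1979]
-/

noncomputable section

namespace Literature.NumberTheory.GaloisRepresentations

namespace GaloisRep

universe u v w

variable {K : Type u} [Field K]

/-- **Katz, Prop. 1.9 with Remark 1.10 (integrality of the Artin conductor of a `λ`-adic
representation), discharged.**  For a number field `K`, a prime `ℓ`, a finite extension `E` of
`ℚ_ℓ`, a finite-dimensional `E`-vector space `M` with its module topology, a finite place `v` of
`K` with `ℓ ≠ char (𝓞 K ⧸ v)`, any prime `𝔓 ∣ v` of `\bar ℤ_K` and every continuous representation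
`ρ : Γ_K → GL(M)`: `∃ n : ℕ, (n : ℝ) = a_𝔓(ρ)`.  Proof:
`exists_natCast_eq_artinConductorAt_lAdic_of_hasseArf` (the tree's reduction of Katz 1.9–1.10 to
the Hasse–Arf theorem) applied to `hasseArf_holds`.
[cite: Katz1988, Ch. 1, Prop. 1.9 and Remark 1.10]
[cite: SerreLocalFields1979, Ch. IV §3, Theorem (Hasse–Arf)] -/
theorem exists_natCast_eq_artinConductorAt_lAdic_holds :
    exists_natCast_eq_artinConductorAt_lAdic.{u, v, w} (K := K) :=
  exists_natCast_eq_artinConductorAt_lAdic_of_hasseArf fun _ _ _ _ _ _ _ _ _ _ => hasseArf_holds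

end GaloisRep

end Literature.NumberTheory.GaloisRepresentations

end
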